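import Literature.Analysis.FluidPDE.EnstrophyGronwall
import Literature.Analysis.FluidPDE.NSCriticalClosureTao
import Literature.Analysis.FluidPDE.SobolevWholeSpace
import Literature.Analysis.FluidPDE.NSWeakStrongUniquenessProofs
import Literature.Analysis.FluidPDE.TaoLocalisation

/-!
# Rung `X_1` (crux `RungReynoldsOne`, stmt-2882), line `lp-vorticity-young-budget`: rate bookkeeping

Along a classical Leray–Hopf Schwartz-datum solution on `ℝ³ × [0,T)` with eventual rate
`√(T−t)‖u(t,x)‖ ≤ √ν`, the a-priori power rates `∫F(curl u(t)) ≤ K₁(T−t)^{-15/16}`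
(`F(y) = (|y|²+1)^{5/4} − 1 ≥ |y|^{5/2}`), `∫|∇u(t)|² ≤ K₂(T−t)^{-1/2}`, `‖u(t,x)‖² ≤ M/(T−t)`
(file `…AprioriDecay`), fed into the Lamb-form slab enstrophy inequality
`∫|∇u(t)|² ≤ ∫|∇u(0)|² + (2ν)⁻¹∫₀ᵗ‖u‖²_{L^{10}}‖curl u‖²_{L^{5/2}}` (stub S4) on the Tao-class
sub-slabs `[0,t]` (stub S5), with `∫|u|^{10} ≤ ‖u‖⁴_∞∫|u|⁶`, Sobolev `‖u‖₆ ≤ K_S‖∇u‖₂`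
(`eLpNorm_six_le_eLpNorm_fderiv_two`) and `∫|curl u|^{5/2} ≤ ∫F(curl u)`, give an integrand
`≲ (T−s)^{-2/5-3/10-3/4} = (T−s)^{-29/20}` and hence the SUBCRITICAL growth
`‖u(t)‖₂² + ‖∇u(t)‖₂² ≤ K (T−t)^{-9/20}` on `[T/2, T)` (`9/20 < 1/2`). [folklore]
-/

noncomputable section

open Set Filter Topology MeasureTheory
open scoped RealInnerProductSpace ENNReal NNReal Laplacian ContDiff
open Literature.Analysis.FluidPDE

namespace Summit.NavierStokesRegularity.NavierStokesRegularity.Theorems.RungReynoldsOne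

-- the problem directory `NavierStokesRegularity/NavierStokesRegularity` forces the duplicated namespace
set_option linter.dupNamespace false

/-- `∫₀ᵗ (T−s)^{-29/20} ds ≤ (20/9)(T−t)^{-9/20}` for `0 ≤ t < T`, as a lower Lebesgue integral. -/
theorem lintegral_Ioo_rpow_sub_le {T t : ℝ} (ht0 : 0 ≤ t) (htT : t < T) :
    ∫⁻ s in Ioo 0 t, ENNReal.ofReal ((T - s) ^ (-(29 / 20 : ℝ))) ≤
      ENNReal.ofReal (20 / 9 * (T - t) ^ (-(9 / 20 : ℝ))) := by
  have hpos : ∀ s ∈ Icc 0 t, 0 < T - s := fun s hs => by linarith [hs.2]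
  have hcont : ContinuousOn (fun s => (T - s) ^ (-(29 / 20 : ℝ))) (Icc 0 t) :=
    (continuousOn_const.sub continuousOn_id).rpow_const fun s hs => Or.inl (hpos s hs).ne'
  have hint : IntegrableOn (fun s => (T - s) ^ (-(29 / 20 : ℝ))) (Ioo 0 t) volume :=
    (hcont.integrableOn_compact isCompact_Icc).mono_set Ioo_subset_Icc_self
  have hnn : 0 ≤ᵐ[volume.restrict (Ioo 0 t)] fun s => (T - s) ^ (-(29 / 20 : ℝ)) := by
    refine (ae_restrict_iff' measurableSet_Ioo).2 (Eventually.of_forall fun s hs => ?_)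
    exact Real.rpow_nonneg (hpos s (Ioo_subset_Icc_self hs)).le _
  rw [← ofReal_integral_eq_lintegral_ofReal hint hnn]
  refine ENNReal.ofReal_le_ofReal ?_
  -- FTC with the antiderivative `s ↦ (20/9) (T − s)^{-9/20}`
  have hderiv : ∀ s ∈ uIcc 0 t,
      HasDerivAt (fun s => 20 / 9 * (T - s) ^ (-(9 / 20 : ℝ))) ((T - s) ^ (-(29 / 20 : ℝ))) s := by
    intro s hs
    rw [uIcc_of_le ht0] at hs
    have h1 : HasDerivAt (fun s => T - s) (-1) s := by simpa using (hasDerivAt_id s).const_sub T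
    have h2 := (h1.rpow_const (p := -(9 / 20 : ℝ)) (Or.inl (hpos s hs).ne')).const_mul (20 / 9)
    refine h2.congr_deriv ?_
    rw [show (-(9 / 20 : ℝ)) - 1 = -(29 / 20 : ℝ) by norm_num]
    ring
  have hFTC := intervalIntegral.integral_eq_sub_of_hasDerivAt hderiv
    ((hcont.mono (by rw [uIcc_of_le ht0])).intervalIntegrable)
  rw [← integral_Ioc_eq_integral_Ioo, ← intervalIntegral.integral_of_le ht0, hFTC]
  have hT0 : 0 ≤ (T - 0) ^ (-(9 / 20 : ℝ)) := Real.rpow_nonneg (by linarith) _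
  linarith

/-- `|y|^{5/2} ≤ F(y) = (|y|²+1)^{5/4} − 1`, in `ℝ≥0∞`. -/
theorem enorm_rpow_five_halves_le_weightF (y : EuclideanSpace ℝ (Fin 3)) :
    ‖y‖ₑ ^ (5 / 2 : ℝ) ≤ ENNReal.ofReal ((‖y‖ ^ 2 + 1) ^ (5 / 4 : ℝ) - 1) := by
  have hy0 : 0 ≤ ‖y‖ := norm_nonneg y
  -- `b = |y|^{1/2}`, `a = (|y|²+1)^{1/4}`: `b⁴ + 1 = a⁴`, `a ≥ b`, `a ≥ 1` ⇒ `a⁵ − b⁵ ≥ 1`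
  set b : ℝ := ‖y‖ ^ (1 / 2 : ℝ) with hb
  set a : ℝ := (‖y‖ ^ 2 + 1) ^ (1 / 4 : ℝ) with ha
  have hb0 : 0 ≤ b := Real.rpow_nonneg hy0 _; have hρ : 1 ≤ ‖y‖ ^ 2 + 1 := by nlinarith [sq_nonneg ‖y‖]
  have ha1 : 1 ≤ a := Real.one_le_rpow hρ (by norm_num)
  have hb4 : b ^ 4 = ‖y‖ ^ 2 := by rw [hb, ← Real.rpow_natCast, ← Real.rpow_mul hy0]; norm_num
  have ha4 : a ^ 4 = ‖y‖ ^ 2 + 1 := by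
    rw [ha, ← Real.rpow_natCast, ← Real.rpow_mul (zero_le_one.trans hρ)]; norm_num
  have hb5 : ‖y‖ ^ (5 / 2 : ℝ) = b ^ 5 := by rw [hb, ← Real.rpow_natCast, ← Real.rpow_mul hy0]; norm_num
  have ha5 : (‖y‖ ^ 2 + 1) ^ (5 / 4 : ℝ) = a ^ 5 := by
    rw [ha, ← Real.rpow_natCast _ 5, ← Real.rpow_mul (zero_le_one.trans hρ)]; norm_num
  have hab : b ≤ a := by
    have : b ^ 4 ≤ a ^ 4 := by rw [hb4, ha4]; linarith
    exact le_of_pow_le_pow_left₀ (by norm_num) (zero_le_one.trans ha1) this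
  have key : b ^ 5 ≤ a ^ 5 - 1 := by
    -- `a⁵ − b⁵ = a·a⁴ − b·b⁴ = a(b⁴+1) − b⁵ ≥ b·b⁴ + 1 − b⁵ = 1`
    have h1 : a ^ 5 = a * (b ^ 4 + 1) := by rw [hb4, ← ha4]; ring
    nlinarith [mul_le_mul_of_nonneg_right hab (by positivity : (0 : ℝ) ≤ b ^ 4)]
  rw [← ofReal_norm, ENNReal.ofReal_rpow_of_nonneg (norm_nonneg _) (by norm_num), hb5, ha5]
  exact ENNReal.ofReal_le_ofReal key

/-- `‖f‖^{10}_{10} ≤ N⁴ ‖f‖⁶₆`-type bound with the pointwise bound `‖f x‖² ≤ c`: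
`∫‖f‖ₑ^{10} ≤ (ofReal c)² ∫‖f‖ₑ^6`. -/
theorem lintegral_enorm_ten_le {f : EuclideanSpace ℝ (Fin 3) → EuclideanSpace ℝ (Fin 3)} {c : ℝ}
    (hf : ∀ x, ‖f x‖ ^ 2 ≤ c) :
    ∫⁻ x, ‖f x‖ₑ ^ (10 : ℝ) ≤ ENNReal.ofReal c ^ 2 * ∫⁻ x, ‖f x‖ₑ ^ (6 : ℝ) := by
  rw [← lintegral_const_mul' _ _ (ENNReal.pow_ne_top ENNReal.ofReal_ne_top)]
  refine lintegral_mono fun x => ?_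
  have h2 : ‖f x‖ₑ ^ 2 ≤ ENNReal.ofReal c := by
    rw [← ofReal_norm, ← ENNReal.ofReal_pow (norm_nonneg _)]
    exact ENNReal.ofReal_le_ofReal (hf x)
  have h10 : ‖f x‖ₑ ^ (10 : ℝ) = (‖f x‖ₑ ^ 2) ^ 2 * ‖f x‖ₑ ^ (6 : ℝ) := by
    rw [show (10 : ℝ) = ((10 : ℕ) : ℝ) by norm_num, show (6 : ℝ) = ((6 : ℕ) : ℝ) by norm_num,
      ENNReal.rpow_natCast, ENNReal.rpow_natCast]
    ring
  rw [h10]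
  gcongr

/-- Sobolev in the line's currency: `∫‖f‖ₑ⁶ ≤ K_S⁶ (∫|∇f|²)³` for a `C¹` field `f ∈ L²(ℝ³)`
(`eLpNorm_six_le_eLpNorm_fderiv_two`, operator-versus-Frobenius norm). -/
theorem lintegral_enorm_six_le_frobenius {f : EuclideanSpace ℝ (Fin 3) → EuclideanSpace ℝ (Fin 3)}
    (hf : ContDiff ℝ 1 f) (h2 : eLpNorm f 2 volume < ⊤) :
    ∫⁻ x, ‖f x‖ₑ ^ (6 : ℝ) ≤
      (SNormLESNormFDerivOfEqConst (EuclideanSpace ℝ (Fin 3))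
          (volume : Measure (EuclideanSpace ℝ (Fin 3))) 2 : ℝ≥0∞) ^ (6 : ℝ) *
        (∫⁻ x, ENNReal.ofReal (frobeniusNormSq (fderiv ℝ f x))) ^ (3 : ℝ) := by
  have hS := eLpNorm_six_le_eLpNorm_fderiv_two (volume : Measure (EuclideanSpace ℝ (Fin 3)))
    (F := EuclideanSpace ℝ (Fin 3)) finrank_euclideanSpace_fin hf h2
  have hD := eLpNorm_two_le_lintegral_frobenius_rpow (volume : Measure (EuclideanSpace ℝ (Fin 3)))
    (fderiv ℝ f)
  have h6 : ∫⁻ x, ‖f x‖ₑ ^ (6 : ℝ) = eLpNorm f 6 volume ^ (6 : ℝ) := by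
    rw [eLpNorm_eq_eLpNorm' (by norm_num) (by norm_num), ENNReal.toReal_ofNat,
      lintegral_rpow_enorm_eq_rpow_eLpNorm' (by norm_num)]
  rw [h6]
  calc eLpNorm f 6 volume ^ (6 : ℝ)
      ≤ ((SNormLESNormFDerivOfEqConst (EuclideanSpace ℝ (Fin 3))
          (volume : Measure (EuclideanSpace ℝ (Fin 3))) 2 : ℝ≥0∞) *
          (∫⁻ x, ENNReal.ofReal (frobeniusNormSq (fderiv ℝ f x))) ^ (1 / 2 : ℝ)) ^ (6 : ℝ) := by
        gcongr
        calc eLpNorm f 6 volume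
            ≤ (SNormLESNormFDerivOfEqConst (EuclideanSpace ℝ (Fin 3))
                (volume : Measure (EuclideanSpace ℝ (Fin 3))) 2 : ℝ≥0∞) *
                eLpNorm (fderiv ℝ f) 2 volume := hS
          _ ≤ _ := by gcongr
    _ = _ := by
        rw [ENNReal.mul_rpow_of_nonneg _ _ (by norm_num), ← ENNReal.rpow_mul]
        norm_num

/-- **Rate bookkeeping.** GIVEN the a-priori power rates (conclusion of
`aprioriDecay_of`), the Lamb-form slab enstrophy inequality (stub S4) and the Tao-class cover
(stub S5): along every classical solution on `ℝ³ × [0,T)`, Leray–Hopf from its rapidly decaying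
datum, with eventual rate `√(T−t)‖u(t,x)‖ ≤ √ν`, there is `K` with
`‖u(t)‖₂² + ‖∇u(t)‖₂² ≤ K (T−t)^{-9/20}` for all `t ∈ [T/2, T)`. -/
theorem enstrophyDecay_of
    (hapriori : ∀ ⦃ν T : ℝ⦄, 0 < ν → 0 < T →
      ∀ ⦃u : ℝ → EuclideanSpace ℝ (Fin 3) → EuclideanSpace ℝ (Fin 3)⦄
        ⦃p : ℝ → EuclideanSpace ℝ (Fin 3) → ℝ⦄,
        IsClassicalNSSolutionOn (Ico 0 T) ν 0 u p → IsLerayHopfOn T ν 0 (u 0) u →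
        HasRapidSpatialDecay (u 0) →
        (∀ᶠ t in 𝓝[<] T, ∀ x, Real.sqrt (T - t) * ‖u t x‖ ≤ Real.sqrt ν) →
        ∃ K₁ K₂ M : ℝ, ∀ t ∈ Ioo 0 T,
          (∫⁻ x, ENNReal.ofReal ((‖curl (u t) x‖ ^ 2 + 1) ^ (5 / 4 : ℝ) - 1) ≤
            ENNReal.ofReal (K₁ * (T - t) ^ (-(15 / 16 : ℝ)))) ∧
          (∫⁻ x, ENNReal.ofReal (frobeniusNormSq (fderiv ℝ (u t) x)) ≤
            ENNReal.ofReal (K₂ * (T - t) ^ (-(1 / 2 : ℝ)))) ∧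
          (∀ x, ‖u t x‖ ^ 2 ≤ M / (T - t)))
    (hL : ∀ ⦃ν T : ℝ⦄, 0 < ν → 0 < T →
      ∀ ⦃u : ℝ → EuclideanSpace ℝ (Fin 3) → EuclideanSpace ℝ (Fin 3)⦄
        ⦃p : ℝ → EuclideanSpace ℝ (Fin 3) → ℝ⦄,
        IsClassicalNSSolutionOn (Icc 0 T) ν 0 u p →
        HasBoundedSobolevNormsOn (Icc 0 T) u →
        HasBoundedSobolevNormsOn (Icc 0 T) (timeDerivWithin (Icc 0 T) u) →
        (∀ n : ℕ, ∃ C : ℝ≥0, ∀ t ∈ Icc 0 T, ∫⁻ x, ‖iteratedFDeriv ℝ n (p t) x‖ₑ ^ 2 ≤ C) →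
      ∀ ⦃s : ℝ⦄, s ∈ Ioc 0 T →
        ∫⁻ x, ENNReal.ofReal (frobeniusNormSq (fderiv ℝ (u s) x)) ≤
          (∫⁻ x, ENNReal.ofReal (frobeniusNormSq (fderiv ℝ (u 0) x))) +
            ENNReal.ofReal ((2 * ν)⁻¹) *
              ∫⁻ t in Ioo 0 s, (∫⁻ x, ‖u t x‖ₑ ^ (10 : ℝ)) ^ (1 / 5 : ℝ) *
                (∫⁻ x, ‖curl (u t) x‖ₑ ^ (5 / 2 : ℝ)) ^ (4 / 5 : ℝ))
    (hC : ∀ ⦃ν T : ℝ⦄, 0 < ν → 0 < T →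
      ∀ ⦃u : ℝ → EuclideanSpace ℝ (Fin 3) → EuclideanSpace ℝ (Fin 3)⦄
        ⦃p : ℝ → EuclideanSpace ℝ (Fin 3) → ℝ⦄,
        IsClassicalNSSolutionOn (Ico 0 T) ν 0 u p → IsLerayHopfOn T ν 0 (u 0) u →
        HasRapidSpatialDecay (u 0) →
      ∀ ⦃T' : ℝ⦄, T' ∈ Ioo 0 T →
        ∃ q : ℝ → EuclideanSpace ℝ (Fin 3) → ℝ,
          IsClassicalNSSolutionOn (Icc 0 T') ν 0 u q ∧
          HasBoundedSobolevNormsOn (Icc 0 T') u ∧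
          HasBoundedSobolevNormsOn (Icc 0 T') (timeDerivWithin (Icc 0 T') u) ∧
          (∀ n : ℕ, ∃ C : ℝ≥0, ∀ t ∈ Icc 0 T', ∫⁻ x, ‖iteratedFDeriv ℝ n (q t) x‖ₑ ^ 2 ≤ C))
    {ν T : ℝ} (hν : 0 < ν) (hT : 0 < T)
    {u : ℝ → EuclideanSpace ℝ (Fin 3) → EuclideanSpace ℝ (Fin 3)}
    {p : ℝ → EuclideanSpace ℝ (Fin 3) → ℝ}
    (hsol : IsClassicalNSSolutionOn (Ico 0 T) ν 0 u p) (hLH : IsLerayHopfOn T ν 0 (u 0) u)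
    (hdec : HasRapidSpatialDecay (u 0))
    (hrate : ∀ᶠ t in 𝓝[<] T, ∀ x, Real.sqrt (T - t) * ‖u t x‖ ≤ Real.sqrt ν) :
    ∃ K : ℝ, ∃ t₀ ∈ Ico 0 T, ∀ t ∈ Ico t₀ T,
      (∫⁻ x, ‖u t x‖ₑ ^ 2) + ∫⁻ x, ENNReal.ofReal (frobeniusNormSq (fderiv ℝ (u t) x)) ≤
        ENNReal.ofReal (K * (T - t) ^ (-(9 / 20 : ℝ))) := by
  obtain ⟨K₁, K₂, M, hb⟩ := hapriori hν hT hsol hLH hdec hrate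
  -- nonnegative versions of the constants
  set k₁ : ℝ := max K₁ 0 with hk₁; set k₂ : ℝ := max K₂ 0 with hk₂; set m : ℝ := max M 0 with hm
  have hk₁0 : 0 ≤ k₁ := le_max_right _ _; have hk₂0 : 0 ≤ k₂ := le_max_right _ _
  have hm0 : 0 ≤ m := le_max_right _ _
  have hΦb : ∀ s ∈ Ioo 0 T, ∫⁻ x, ENNReal.ofReal ((‖curl (u s) x‖ ^ 2 + 1) ^ (5 / 4 : ℝ) - 1) ≤
      ENNReal.ofReal (k₁ * (T - s) ^ (-(15 / 16 : ℝ))) := fun s hs =>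
    (hb s hs).1.trans (ENNReal.ofReal_le_ofReal (mul_le_mul_of_nonneg_right (le_max_left _ _)
      (Real.rpow_nonneg (sub_pos.2 hs.2).le _)))
  have hGb : ∀ s ∈ Ioo 0 T, ∫⁻ x, ENNReal.ofReal (frobeniusNormSq (fderiv ℝ (u s) x)) ≤
      ENNReal.ofReal (k₂ * (T - s) ^ (-(1 / 2 : ℝ))) := fun s hs =>
    (hb s hs).2.1.trans (ENNReal.ofReal_le_ofReal (mul_le_mul_of_nonneg_right (le_max_left _ _)
      (Real.rpow_nonneg (sub_pos.2 hs.2).le _)))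
  have hub : ∀ s ∈ Ioo 0 T, ∀ x, ‖u s x‖ ^ 2 ≤ m / (T - s) := fun s hs x =>
    ((hb s hs).2.2 x).trans (div_le_div_of_nonneg_right (le_max_left _ _) (sub_pos.2 hs.2).le)
  -- the Sobolev constant and the combined constant of the integrand
  set KS : ℝ≥0 := SNormLESNormFDerivOfEqConst (EuclideanSpace ℝ (Fin 3))
    (volume : Measure (EuclideanSpace ℝ (Fin 3))) 2 with hKS
  set cL : ℝ := m ^ 2 * ((KS : ℝ) ^ 6 * k₂ ^ 3) with hcL
  have hcL0 : 0 ≤ cL := by positivity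
  set c₀ : ℝ := cL ^ (1 / 5 : ℝ) * k₁ ^ (4 / 5 : ℝ) with hc₀
  have hc₀0 : 0 ≤ c₀ := by positivity
  -- THE INTEGRAND BOUND: `I(s) ≤ c₀ (T−s)^{-29/20}` on `(0, T)`
  have hI : ∀ s ∈ Ioo 0 T, (∫⁻ x, ‖u s x‖ₑ ^ (10 : ℝ)) ^ (1 / 5 : ℝ) *
      (∫⁻ x, ‖curl (u s) x‖ₑ ^ (5 / 2 : ℝ)) ^ (4 / 5 : ℝ) ≤
      ENNReal.ofReal (c₀ * (T - s) ^ (-(29 / 20 : ℝ))) := by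
    intro s hs
    have hTs : 0 < T - s := sub_pos.2 hs.2; have hsI : s ∈ Icc 0 T := ⟨hs.1.le, hs.2.le⟩
    -- the vorticity factor
    have hJ : (∫⁻ x, ‖curl (u s) x‖ₑ ^ (5 / 2 : ℝ)) ^ (4 / 5 : ℝ) ≤
        ENNReal.ofReal (k₁ ^ (4 / 5 : ℝ) * (T - s) ^ (-(3 / 4 : ℝ))) := by
      have h1 : ∫⁻ x, ‖curl (u s) x‖ₑ ^ (5 / 2 : ℝ) ≤ ENNReal.ofReal (k₁ * (T - s) ^ (-(15 / 16 : ℝ))) :=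
        (lintegral_mono fun x => enorm_rpow_five_halves_le_weightF (curl (u s) x)).trans (hΦb s hs)
      calc (∫⁻ x, ‖curl (u s) x‖ₑ ^ (5 / 2 : ℝ)) ^ (4 / 5 : ℝ)
          ≤ (ENNReal.ofReal (k₁ * (T - s) ^ (-(15 / 16 : ℝ)))) ^ (4 / 5 : ℝ) := by gcongr
        _ = ENNReal.ofReal (k₁ ^ (4 / 5 : ℝ) * (T - s) ^ (-(3 / 4 : ℝ))) := by
            rw [ENNReal.ofReal_rpow_of_nonneg (mul_nonneg hk₁0 (Real.rpow_nonneg hTs.le _))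
              (by norm_num), Real.mul_rpow hk₁0 (Real.rpow_nonneg hTs.le _),
              ← Real.rpow_mul hTs.le]
            norm_num
    -- the velocity factor: `∫‖u‖ₑ^{10} ≤ (m/(T−s))² K_S⁶ (k₂ (T−s)^{-1/2})³ = cL (T−s)^{-7/2}`
    have h6 : ∫⁻ x, ‖u s x‖ₑ ^ (6 : ℝ) ≤ (KS : ℝ≥0∞) ^ (6 : ℝ) *
        (ENNReal.ofReal (k₂ * (T - s) ^ (-(1 / 2 : ℝ)))) ^ (3 : ℝ) :=
      (lintegral_enorm_six_le_frobenius ((hsol.contDiff_velocity ⟨hs.1.le, hs.2⟩).of_le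
        (by norm_cast)) (hLH.memLp s hsI).eLpNorm_lt_top).trans (by gcongr; exact hGb s hs)
    have hLs : ∫⁻ x, ‖u s x‖ₑ ^ (10 : ℝ) ≤ ENNReal.ofReal (cL * (T - s) ^ (-(7 / 2 : ℝ))) := by
      calc ∫⁻ x, ‖u s x‖ₑ ^ (10 : ℝ)
          ≤ ENNReal.ofReal (m / (T - s)) ^ 2 * ∫⁻ x, ‖u s x‖ₑ ^ (6 : ℝ) :=
            lintegral_enorm_ten_le (hub s hs)
        _ ≤ ENNReal.ofReal (m / (T - s)) ^ 2 * ((KS : ℝ≥0∞) ^ (6 : ℝ) *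
            (ENNReal.ofReal (k₂ * (T - s) ^ (-(1 / 2 : ℝ)))) ^ (3 : ℝ)) := by gcongr
        _ = ENNReal.ofReal (cL * (T - s) ^ (-(7 / 2 : ℝ))) := by
            have hk2r : 0 ≤ k₂ * (T - s) ^ (-(1 / 2 : ℝ)) := mul_nonneg hk₂0 (Real.rpow_nonneg hTs.le _)
            rw [← ENNReal.ofReal_coe_nnreal, ENNReal.ofReal_rpow_of_nonneg (NNReal.coe_nonneg _)
              (by norm_num), ENNReal.ofReal_rpow_of_nonneg hk2r (by norm_num),
              ← ENNReal.ofReal_pow (div_nonneg hm0 hTs.le), ← ENNReal.ofReal_mul (by positivity),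
              ← ENNReal.ofReal_mul (by positivity)]
            congr 1
            rw [hcL, Real.mul_rpow hk₂0 (Real.rpow_nonneg hTs.le _), ← Real.rpow_mul hTs.le,
              div_pow, show (KS : ℝ) ^ (6 : ℝ) = (KS : ℝ) ^ (6 : ℕ) by
                rw [← Real.rpow_natCast]; norm_num,
              show k₂ ^ (3 : ℝ) = k₂ ^ (3 : ℕ) by rw [← Real.rpow_natCast]; norm_num]
            have hpow2 : (T - s) ^ 2 = (T - s) ^ (2 : ℝ) := by
              rw [← Real.rpow_natCast]; norm_num
            rw [hpow2, div_eq_mul_inv, ← Real.rpow_neg hTs.le]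
            have hexp : (T - s) ^ (-(2 : ℝ)) * (T - s) ^ (-(1 / 2 : ℝ) * 3) = (T - s) ^ (-(7 / 2 : ℝ)) := by
              rw [← Real.rpow_add hTs]; norm_num
            rw [← hexp]
            ring
    have hL5 : (∫⁻ x, ‖u s x‖ₑ ^ (10 : ℝ)) ^ (1 / 5 : ℝ) ≤
        ENNReal.ofReal (cL ^ (1 / 5 : ℝ) * (T - s) ^ (-(7 / 10 : ℝ))) := by
      calc (∫⁻ x, ‖u s x‖ₑ ^ (10 : ℝ)) ^ (1 / 5 : ℝ)
          ≤ (ENNReal.ofReal (cL * (T - s) ^ (-(7 / 2 : ℝ)))) ^ (1 / 5 : ℝ) := by gcongr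
        _ = ENNReal.ofReal (cL ^ (1 / 5 : ℝ) * (T - s) ^ (-(7 / 10 : ℝ))) := by
            rw [ENNReal.ofReal_rpow_of_nonneg (mul_nonneg hcL0 (Real.rpow_nonneg hTs.le _))
              (by norm_num), Real.mul_rpow hcL0 (Real.rpow_nonneg hTs.le _),
              ← Real.rpow_mul hTs.le]
            norm_num
    -- combine
    calc (∫⁻ x, ‖u s x‖ₑ ^ (10 : ℝ)) ^ (1 / 5 : ℝ) * (∫⁻ x, ‖curl (u s) x‖ₑ ^ (5 / 2 : ℝ)) ^ (4 / 5 : ℝ)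
        ≤ ENNReal.ofReal (cL ^ (1 / 5 : ℝ) * (T - s) ^ (-(7 / 10 : ℝ))) *
            ENNReal.ofReal (k₁ ^ (4 / 5 : ℝ) * (T - s) ^ (-(3 / 4 : ℝ))) := mul_le_mul' hL5 hJ
      _ = ENNReal.ofReal (c₀ * (T - s) ^ (-(29 / 20 : ℝ))) := by
          rw [← ENNReal.ofReal_mul (mul_nonneg (Real.rpow_nonneg hcL0 _) (Real.rpow_nonneg hTs.le _))]
          congr 1
          have hexp : (T - s) ^ (-(7 / 10 : ℝ)) * (T - s) ^ (-(3 / 4 : ℝ)) = (T - s) ^ (-(29 / 20 : ℝ)) := by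
            rw [← Real.rpow_add hTs]; norm_num
          rw [hc₀, ← hexp]
          ring
  -- finiteness of the initial enstrophy (Tao cover at `T/2`) and the energy bound
  have hT2 : T / 2 ∈ Ioo 0 T := ⟨by linarith, by linarith⟩
  obtain ⟨q₀, -, hu₀, -, -⟩ := hC hν hT hsol hLH hdec hT2
  obtain ⟨C₁, hC₁⟩ := hu₀ 1
  have hG0 : ∫⁻ x, ENNReal.ofReal (frobeniusNormSq (fderiv ℝ (u 0) x)) ≤ 3 * C₁ := by
    calc ∫⁻ x, ENNReal.ofReal (frobeniusNormSq (fderiv ℝ (u 0) x))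
        ≤ ∫⁻ x, 3 * ‖iteratedFDeriv ℝ 1 (u 0) x‖ₑ ^ 2 := lintegral_mono fun x => by
          rw [← ofReal_norm, norm_iteratedFDeriv_one, ofReal_norm]
          exact ofReal_frobeniusNormSq_le_three_mul_enorm_sq _
      _ = 3 * ∫⁻ x, ‖iteratedFDeriv ℝ 1 (u 0) x‖ₑ ^ 2 := lintegral_const_mul' _ _ (by norm_num)
      _ ≤ 3 * C₁ := by gcongr; exact hC₁ 0 ⟨le_rfl, hT2.1.le⟩
  have hG0top : ∫⁻ x, ENNReal.ofReal (frobeniusNormSq (fderiv ℝ (u 0) x)) ≠ ⊤ :=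
    (hG0.trans_lt (ENNReal.mul_lt_top (by norm_num) ENNReal.coe_lt_top)).ne
  set G0 : ℝ := (∫⁻ x, ENNReal.ofReal (frobeniusNormSq (fderiv ℝ (u 0) x))).toReal with hG0def
  set E0 : ℝ := max (2 * VectorCalculus.kineticEnergy (u 0)) 0 with hE0def
  have hE0 : 0 ≤ E0 := le_max_right _ _; have hG0nn : 0 ≤ G0 := ENNReal.toReal_nonneg
  have hEt : ∀ t ∈ Icc 0 T, ∫⁻ x, ‖u t x‖ₑ ^ 2 ≤ ENNReal.ofReal E0 := fun t ht =>
    (hLH.lintegral_enorm_sq_le hν.le ht).trans (ENNReal.ofReal_le_ofReal (le_max_left _ _))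
  -- the constant
  set K : ℝ := (E0 + G0) * T ^ (9 / 20 : ℝ) + (2 * ν)⁻¹ * (c₀ * (20 / 9)) with hK
  refine ⟨K, T / 2, ⟨by linarith, by linarith⟩, fun t ht => ?_⟩
  have ht0 : 0 < t := lt_of_lt_of_le hT2.1 ht.1
  have htI : t ∈ Ioo 0 T := ⟨ht0, ht.2⟩; have hTt : 0 < T - t := sub_pos.2 ht.2
  obtain ⟨q, hsolt, hut, hutt, hqt⟩ := hC hν hT hsol hLH hdec htI
  have hmain := hL hν ht0 hsolt hut hutt hqt ⟨ht0, le_rfl⟩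
  -- the time integral of the production bound
  have hint : ∫⁻ s in Ioo 0 t, (∫⁻ x, ‖u s x‖ₑ ^ (10 : ℝ)) ^ (1 / 5 : ℝ) *
      (∫⁻ x, ‖curl (u s) x‖ₑ ^ (5 / 2 : ℝ)) ^ (4 / 5 : ℝ) ≤
      ENNReal.ofReal (c₀ * (20 / 9 * (T - t) ^ (-(9 / 20 : ℝ)))) := by
    calc ∫⁻ s in Ioo 0 t, (∫⁻ x, ‖u s x‖ₑ ^ (10 : ℝ)) ^ (1 / 5 : ℝ) *
          (∫⁻ x, ‖curl (u s) x‖ₑ ^ (5 / 2 : ℝ)) ^ (4 / 5 : ℝ)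
        ≤ ∫⁻ s in Ioo 0 t, ENNReal.ofReal c₀ * ENNReal.ofReal ((T - s) ^ (-(29 / 20 : ℝ))) := by
          refine setLIntegral_mono' measurableSet_Ioo fun s hs => ?_
          rw [← ENNReal.ofReal_mul hc₀0]
          exact hI s ⟨hs.1, hs.2.trans ht.2⟩
      _ = ENNReal.ofReal c₀ * ∫⁻ s in Ioo 0 t, ENNReal.ofReal ((T - s) ^ (-(29 / 20 : ℝ))) :=
          lintegral_const_mul' _ _ ENNReal.ofReal_ne_top
      _ ≤ ENNReal.ofReal c₀ * ENNReal.ofReal (20 / 9 * (T - t) ^ (-(9 / 20 : ℝ))) := by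
          gcongr; exact lintegral_Ioo_rpow_sub_le ht0.le ht.2
      _ = ENNReal.ofReal (c₀ * (20 / 9 * (T - t) ^ (-(9 / 20 : ℝ)))) := (ENNReal.ofReal_mul hc₀0).symm
  -- assemble
  have hpos9 : 0 ≤ (T - t) ^ (-(9 / 20 : ℝ)) := Real.rpow_nonneg hTt.le _; have hν2 : 0 ≤ (2 * ν)⁻¹ := by positivity
  have hGt : ∫⁻ x, ENNReal.ofReal (frobeniusNormSq (fderiv ℝ (u t) x)) ≤
      ENNReal.ofReal (G0 + (2 * ν)⁻¹ * (c₀ * (20 / 9 * (T - t) ^ (-(9 / 20 : ℝ))))) := by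
    refine hmain.trans ?_
    rw [ENNReal.ofReal_add hG0nn (by positivity), ENNReal.ofReal_mul hν2, ENNReal.ofReal_toReal hG0top]
    gcongr
  -- `E0 + G0 ≤ (E0 + G0) T^{9/20} (T − t)^{-9/20}`
  have hone : 1 ≤ T ^ (9 / 20 : ℝ) * (T - t) ^ (-(9 / 20 : ℝ)) := by
    have h1 : T ^ (-(9 / 20 : ℝ)) ≤ (T - t) ^ (-(9 / 20 : ℝ)) := by
      rw [Real.rpow_neg hTt.le, Real.rpow_neg hT.le]
      exact inv_anti₀ (Real.rpow_pos_of_pos hTt _)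
        (Real.rpow_le_rpow hTt.le (by linarith [ht0]) (by norm_num))
    have h2 : T ^ (9 / 20 : ℝ) * T ^ (-(9 / 20 : ℝ)) = 1 := by
      rw [Real.rpow_neg hT.le, mul_inv_cancel₀ (Real.rpow_pos_of_pos hT _).ne']
    calc (1 : ℝ) = T ^ (9 / 20 : ℝ) * T ^ (-(9 / 20 : ℝ)) := h2.symm
      _ ≤ T ^ (9 / 20 : ℝ) * (T - t) ^ (-(9 / 20 : ℝ)) :=
          mul_le_mul_of_nonneg_left h1 (Real.rpow_nonneg hT.le _)
  calc (∫⁻ x, ‖u t x‖ₑ ^ 2) + ∫⁻ x, ENNReal.ofReal (frobeniusNormSq (fderiv ℝ (u t) x))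
      ≤ ENNReal.ofReal E0 +
          ENNReal.ofReal (G0 + (2 * ν)⁻¹ * (c₀ * (20 / 9 * (T - t) ^ (-(9 / 20 : ℝ))))) :=
        add_le_add (hEt t ⟨ht0.le, ht.2.le⟩) hGt
    _ = ENNReal.ofReal (E0 + (G0 + (2 * ν)⁻¹ * (c₀ * (20 / 9 * (T - t) ^ (-(9 / 20 : ℝ)))))) :=
        (ENNReal.ofReal_add hE0 (by positivity)).symm
    _ ≤ ENNReal.ofReal (K * (T - t) ^ (-(9 / 20 : ℝ))) := by
        refine ENNReal.ofReal_le_ofReal ?_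
        have hEG : 0 ≤ E0 + G0 := add_nonneg hE0 hG0nn
        have h3 : E0 + G0 ≤ (E0 + G0) * (T ^ (9 / 20 : ℝ) * (T - t) ^ (-(9 / 20 : ℝ))) :=
          le_mul_of_one_le_right hEG hone
        rw [hK]
        nlinarith [h3, hpos9, hc₀0, hν2]

/-- **Stub S7b of the line `lp-vorticity-young-budget` (registered form of `enstrophyDecay_of`).**
A-priori power rates + Lamb-form enstrophy slab inequality + Tao cover ⇒ subcritical enstrophy
growth `‖u(t)‖₂² + ‖∇u(t)‖₂² ≤ K(T−t)^{-9/20}` near `T` along rate-one solutions. -/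
theorem stub_enstrophyDecayOf :
    (∀ ⦃ν T : ℝ⦄, 0 < ν → 0 < T →
      ∀ ⦃u : ℝ → EuclideanSpace ℝ (Fin 3) → EuclideanSpace ℝ (Fin 3)⦄
        ⦃p : ℝ → EuclideanSpace ℝ (Fin 3) → ℝ⦄,
        IsClassicalNSSolutionOn (Ico 0 T) ν 0 u p → IsLerayHopfOn T ν 0 (u 0) u →
        HasRapidSpatialDecay (u 0) →
        (∀ᶠ t in 𝓝[<] T, ∀ x, Real.sqrt (T - t) * ‖u t x‖ ≤ Real.sqrt ν) →
        ∃ K₁ K₂ M : ℝ, ∀ t ∈ Ioo 0 T,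
          (∫⁻ x, ENNReal.ofReal ((‖curl (u t) x‖ ^ 2 + 1) ^ (5 / 4 : ℝ) - 1) ≤
            ENNReal.ofReal (K₁ * (T - t) ^ (-(15 / 16 : ℝ)))) ∧
          (∫⁻ x, ENNReal.ofReal (frobeniusNormSq (fderiv ℝ (u t) x)) ≤
            ENNReal.ofReal (K₂ * (T - t) ^ (-(1 / 2 : ℝ)))) ∧
          (∀ x, ‖u t x‖ ^ 2 ≤ M / (T - t))) →
    (∀ ⦃ν T : ℝ⦄, 0 < ν → 0 < T →
      ∀ ⦃u : ℝ → EuclideanSpace ℝ (Fin 3) → EuclideanSpace ℝ (Fin 3)⦄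
        ⦃p : ℝ → EuclideanSpace ℝ (Fin 3) → ℝ⦄,
        IsClassicalNSSolutionOn (Icc 0 T) ν 0 u p →
        HasBoundedSobolevNormsOn (Icc 0 T) u →
        HasBoundedSobolevNormsOn (Icc 0 T) (timeDerivWithin (Icc 0 T) u) →
        (∀ n : ℕ, ∃ C : ℝ≥0, ∀ t ∈ Icc 0 T, ∫⁻ x, ‖iteratedFDeriv ℝ n (p t) x‖ₑ ^ 2 ≤ C) →
      ∀ ⦃s : ℝ⦄, s ∈ Ioc 0 T →
        ∫⁻ x, ENNReal.ofReal (frobeniusNormSq (fderiv ℝ (u s) x)) ≤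
          (∫⁻ x, ENNReal.ofReal (frobeniusNormSq (fderiv ℝ (u 0) x))) +
            ENNReal.ofReal ((2 * ν)⁻¹) *
              ∫⁻ t in Ioo 0 s, (∫⁻ x, ‖u t x‖ₑ ^ (10 : ℝ)) ^ (1 / 5 : ℝ) *
                (∫⁻ x, ‖curl (u t) x‖ₑ ^ (5 / 2 : ℝ)) ^ (4 / 5 : ℝ)) →
    (∀ ⦃ν T : ℝ⦄, 0 < ν → 0 < T →
      ∀ ⦃u : ℝ → EuclideanSpace ℝ (Fin 3) → EuclideanSpace ℝ (Fin 3)⦄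
        ⦃p : ℝ → EuclideanSpace ℝ (Fin 3) → ℝ⦄,
        IsClassicalNSSolutionOn (Ico 0 T) ν 0 u p → IsLerayHopfOn T ν 0 (u 0) u →
        HasRapidSpatialDecay (u 0) →
      ∀ ⦃T' : ℝ⦄, T' ∈ Ioo 0 T →
        ∃ q : ℝ → EuclideanSpace ℝ (Fin 3) → ℝ,
          IsClassicalNSSolutionOn (Icc 0 T') ν 0 u q ∧
          HasBoundedSobolevNormsOn (Icc 0 T') u ∧
          HasBoundedSobolevNormsOn (Icc 0 T') (timeDerivWithin (Icc 0 T') u) ∧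
          (∀ n : ℕ, ∃ C : ℝ≥0, ∀ t ∈ Icc 0 T', ∫⁻ x, ‖iteratedFDeriv ℝ n (q t) x‖ₑ ^ 2 ≤ C)) →
    ∀ ⦃ν T : ℝ⦄, 0 < ν → 0 < T →
    ∀ ⦃u : ℝ → EuclideanSpace ℝ (Fin 3) → EuclideanSpace ℝ (Fin 3)⦄
      ⦃p : ℝ → EuclideanSpace ℝ (Fin 3) → ℝ⦄,
      IsClassicalNSSolutionOn (Ico 0 T) ν 0 u p → IsLerayHopfOn T ν 0 (u 0) u →
      HasRapidSpatialDecay (u 0) →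
      (∀ᶠ t in 𝓝[<] T, ∀ x, Real.sqrt (T - t) * ‖u t x‖ ≤ Real.sqrt ν) →
      ∃ K : ℝ, ∃ t₀ ∈ Ico 0 T, ∀ t ∈ Ico t₀ T,
        (∫⁻ x, ‖u t x‖ₑ ^ 2) + ∫⁻ x, ENNReal.ofReal (frobeniusNormSq (fderiv ℝ (u t) x)) ≤
          ENNReal.ofReal (K * (T - t) ^ (-(9 / 20 : ℝ))) :=
  fun h₁ h₂ h₃ _ν _T hν hT _u _p hsol hLH hdec hrate => enstrophyDecay_of h₁ h₂ h₃ hν hT hsol hLH hdec hrate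

end Summit.NavierStokesRegularity.NavierStokesRegularity.Theorems.RungReynoldsOne

end
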